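import Literature.Analysis.FluidPDE.CompressibleEulerAprioriBounds
import HarnessLib

/-!
# Derivative-only (homogeneous) Sobolev energies of orders `1..m` for the primitive Euler unknowns
# on `𝕋³`

Analysis/FluidPDE support file (definitions with proved API; no named facts). Companion of
`CompressibleEulerAprioriBounds.lean`: there the level-`m` energy
`E_m = Σ_{|w| ≤ m} N_w` (`levelEnergy`) of a primitive solution `(ρ, u, ϑ)` of the
non-isentropic compressible Euler equations sums over ALL words `w` of length `≤ m`, including
the empty word (the `L²` mass of the fields themselves). For the HOMOGENEOUS form of Majda's
`H^m` energy inequality (Majda 1984, Ch. 2 §2.1, Thm 2.2, estimate (2.38) — Kato 1975, Thm II: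
the derivative part `‖∇U‖_{H^{m-1}}` obeys a LINEAR differential inequality whose rate depends
only on the `C¹` size of the solution, so that `D_m(t) ≤ C · D_m(0)` with NO additive term) one
needs the derivative-only energies

* `derivLevelEnergy ρ u ϑ m t = Σ_{1 ≤ |w| ≤ m} N_w(t)` (`N_w = wordEnergy`, the unweighted `L²`
  energy of `∂^w ρ, ∂^w u, ∂^w ϑ`), and
* `weightedDerivLevelEnergy ζ ρ u ϑ m t = Σ_{1 ≤ |w| ≤ m} W_w(t)` (`W_w = weightedWordEnergy ζ`,
  the symmetrised energy with the weights `A = ϑ(ρζ)'/ρ`, `ρ`, `C = 3ρ/(2ϑ)`),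

together with the bookkeeping `N_w ≤ D_m` for `1 ≤ |w| ≤ m`, `∫ (∂^w φ_k)² ≤ D_m` for each of the
five scalar unknowns, `D_m ≤ E_m`, monotonicity in `m`. The energy inequality itself
(`derivLevelEnergy_three_le`) is in `CompressibleEulerHomogeneousEnergyStep.lean`.

## References

* A. Majda, *Compressible Fluid Flow and Systems of Conservation Laws in Several Space
  Variables*, Springer 1984, Ch. 2 §2.1, Thm 2.2 and (2.38). [Majda1984]
* T. Kato, The Cauchy problem for quasi-linear symmetric hyperbolic systems, Arch. Rational
  Mech. Anal. 58 (1975) 181–205, Thm II. [Kato1975]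
-/

noncomputable section

open Set Function MeasureTheory Filter
open scoped ContDiff Topology

namespace Literature.Analysis.FluidPDE

namespace CompressibleEuler

open Literature.Analysis.FunctionSpaces Literature.Analysis.FunctionSpaces.Torus
open Literature.Analysis.FunctionSpaces.Torus.DiffMonomial

variable {ζ : ℝ → ℝ} {ρ ϑ : ℝ → UnitAddTorus (Fin 3) → ℝ} {u : ℝ → UnitAddTorus (Fin 3) → EuclideanSpace ℝ (Fin 3)}

/-! ### The derivative-only energies -/

/-- **The derivative-only level-`m` energy** `D_m(t) = Σ_{1 ≤ |w| ≤ m} N_w(t)`: the sum of the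
unweighted `L²` energies `N_w = ∫ (∂^wρ)² + Σₖ ∫ (∂^wuₖ)² + ∫ (∂^wϑ)²` over all NONEMPTY words of
length `≤ m` (`‖∇(ρ,u,ϑ)(t)‖²_{H^{m-1}}` written with all words; no order-zero term).
[cite: Majda1984, Ch. 2 §2.1 Thm 2.2 (2.38)] -/
def derivLevelEnergy (ρ : ℝ → UnitAddTorus (Fin 3) → ℝ) (u : ℝ → UnitAddTorus (Fin 3) → EuclideanSpace ℝ (Fin 3)) (ϑ : ℝ → UnitAddTorus (Fin 3) → ℝ) (m : ℕ) (t : ℝ) : ℝ :=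
  ∑ n ∈ Finset.Icc 1 m, ∑ w : Fin n → Fin 3, wordEnergy ρ u ϑ (List.ofFn w) t

/-- **The symmetrised derivative-only level-`m` energy** `Σ_{1 ≤ |w| ≤ m} W_w(t)`, `W_w` the
symmetrised energy `∫ (A (∂^wρ)² + ρ Σₖ(∂^wuₖ)² + C (∂^wϑ)²)` of `weightedWordEnergy`.
[cite: Majda1984, Ch. 2 §2.1 Thm 2.2 (2.9)–(2.10)] -/
def weightedDerivLevelEnergy (ζ : ℝ → ℝ) (ρ : ℝ → UnitAddTorus (Fin 3) → ℝ) (u : ℝ → UnitAddTorus (Fin 3) → EuclideanSpace ℝ (Fin 3)) (ϑ : ℝ → UnitAddTorus (Fin 3) → ℝ)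
    (m : ℕ) (t : ℝ) : ℝ :=
  ∑ n ∈ Finset.Icc 1 m, ∑ w : Fin n → Fin 3, weightedWordEnergy ζ ρ u ϑ (List.ofFn w) t

/-- `D_m ≥ 0`. [folklore] -/
theorem derivLevelEnergy_nonneg (m : ℕ) (t : ℝ) : 0 ≤ derivLevelEnergy ρ u ϑ m t :=
  Finset.sum_nonneg fun _ _ => Finset.sum_nonneg fun _ _ => wordEnergy_nonneg _ _

/-- A single nonempty word is dominated by the derivative-only level energy: `N_w ≤ D_m` for
`1 ≤ |w| ≤ m`. [folklore] -/
theorem wordEnergy_le_derivLevelEnergy {w : List (Fin 3)} {m : ℕ} (hw1 : 1 ≤ w.length)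
    (hw : w.length ≤ m) (t : ℝ) : wordEnergy ρ u ϑ w t ≤ derivLevelEnergy ρ u ϑ m t := by
  unfold derivLevelEnergy
  have h1 : wordEnergy ρ u ϑ w t = wordEnergy ρ u ϑ (List.ofFn w.get) t := by rw [List.ofFn_get]
  rw [h1]
  calc wordEnergy ρ u ϑ (List.ofFn w.get) t
      ≤ ∑ w' : Fin w.length → Fin 3, wordEnergy ρ u ϑ (List.ofFn w') t :=
        Finset.single_le_sum (f := fun w' : Fin w.length → Fin 3 => wordEnergy ρ u ϑ (List.ofFn w') t)
          (fun _ _ => wordEnergy_nonneg _ _) (Finset.mem_univ w.get)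
    _ ≤ ∑ n ∈ Finset.Icc 1 m, ∑ w' : Fin n → Fin 3, wordEnergy ρ u ϑ (List.ofFn w') t :=
        Finset.single_le_sum (f := fun n => ∑ w' : Fin n → Fin 3, wordEnergy ρ u ϑ (List.ofFn w') t)
          (fun _ _ => Finset.sum_nonneg fun _ _ => wordEnergy_nonneg _ _)
          (Finset.mem_Icc.2 ⟨hw1, hw⟩)

/-- The derivative-only level energy is monotone in the level. [folklore] -/
theorem derivLevelEnergy_mono {m m' : ℕ} (h : m ≤ m') (t : ℝ) :
    derivLevelEnergy ρ u ϑ m t ≤ derivLevelEnergy ρ u ϑ m' t :=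
  Finset.sum_le_sum_of_subset_of_nonneg (Finset.Icc_subset_Icc le_rfl h)
    fun _ _ _ => Finset.sum_nonneg fun _ _ => wordEnergy_nonneg _ _

/-- The derivative-only energy is dominated by the full level energy: `D_m ≤ E_m`. [folklore] -/
theorem derivLevelEnergy_le_levelEnergy (m : ℕ) (t : ℝ) :
    derivLevelEnergy ρ u ϑ m t ≤ levelEnergy ρ u ϑ m t :=
  Finset.sum_le_sum_of_subset_of_nonneg
    (fun _ hn => Finset.mem_range.2 (Nat.lt_succ_of_le (Finset.mem_Icc.1 hn).2))
    fun _ _ _ => Finset.sum_nonneg fun _ _ => wordEnergy_nonneg _ _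

/-- `L²` norms of single components are dominated by `D_m` (nonempty words): density. [folklore] -/
theorem integral_sq_rho_le_derivLevelEnergy {w : List (Fin 3)} {m : ℕ} (hw1 : 1 ≤ w.length)
    (hw : w.length ≤ m) (t : ℝ) :
    ∫ y, iterPartialDeriv w (ρ t) y ^ 2 ≤ derivLevelEnergy ρ u ϑ m t := by
  refine le_trans ?_ (wordEnergy_le_derivLevelEnergy hw1 hw t)
  have hs : 0 ≤ ∑ k, ∫ y, iterPartialDeriv w (fun y => u t y k) y ^ 2 :=
    Finset.sum_nonneg fun k _ => integral_nonneg fun y => sq_nonneg _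
  have hθ : 0 ≤ ∫ y, iterPartialDeriv w (ϑ t) y ^ 2 := integral_nonneg fun y => sq_nonneg _
  unfold wordEnergy
  linarith

/-- `L²` norms of single components are dominated by `D_m` (nonempty words): velocity. [folklore] -/
theorem integral_sq_vel_le_derivLevelEnergy {w : List (Fin 3)} {m : ℕ} (hw1 : 1 ≤ w.length)
    (hw : w.length ≤ m) (t : ℝ) (k : Fin 3) :
    ∫ y, iterPartialDeriv w (fun y => u t y k) y ^ 2 ≤ derivLevelEnergy ρ u ϑ m t := by
  refine le_trans ?_ (wordEnergy_le_derivLevelEnergy hw1 hw t)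
  have h1 : ∫ y, iterPartialDeriv w (fun y => u t y k) y ^ 2 ≤
      ∑ k, ∫ y, iterPartialDeriv w (fun y => u t y k) y ^ 2 :=
    Finset.single_le_sum (f := fun k => ∫ y, iterPartialDeriv w (fun y => u t y k) y ^ 2)
      (fun _ _ => integral_nonneg fun _ => sq_nonneg _) (Finset.mem_univ k)
  have hρ : 0 ≤ ∫ y, iterPartialDeriv w (ρ t) y ^ 2 := integral_nonneg fun y => sq_nonneg _
  have hθ : 0 ≤ ∫ y, iterPartialDeriv w (ϑ t) y ^ 2 := integral_nonneg fun y => sq_nonneg _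
  unfold wordEnergy
  linarith

/-- `L²` norms of single components are dominated by `D_m` (nonempty words): temperature.
[folklore] -/
theorem integral_sq_theta_le_derivLevelEnergy {w : List (Fin 3)} {m : ℕ} (hw1 : 1 ≤ w.length)
    (hw : w.length ≤ m) (t : ℝ) :
    ∫ y, iterPartialDeriv w (ϑ t) y ^ 2 ≤ derivLevelEnergy ρ u ϑ m t := by
  refine le_trans ?_ (wordEnergy_le_derivLevelEnergy hw1 hw t)
  have hs : 0 ≤ ∑ k, ∫ y, iterPartialDeriv w (fun y => u t y k) y ^ 2 :=
    Finset.sum_nonneg fun k _ => integral_nonneg fun y => sq_nonneg _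
  have hρ : 0 ≤ ∫ y, iterPartialDeriv w (ρ t) y ^ 2 := integral_nonneg fun y => sq_nonneg _
  unfold wordEnergy
  linarith

/-- All five fields at once: `∫ (∂^w φ_k)² ≤ D_m` for `1 ≤ |w| ≤ m`. [folklore] -/
theorem integral_sq_primFields_le_derivLevelEnergy {w : List (Fin 3)} {m : ℕ} (hw1 : 1 ≤ w.length)
    (hw : w.length ≤ m) (t : ℝ) :
    ∀ k : PIdx, ∫ y, iterPartialDeriv w (primFields ρ u ϑ t k) y ^ 2 ≤ derivLevelEnergy ρ u ϑ m t
  | none => integral_sq_rho_le_derivLevelEnergy hw1 hw t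
  | some none => integral_sq_theta_le_derivLevelEnergy hw1 hw t
  | some (some k) => integral_sq_vel_le_derivLevelEnergy hw1 hw t k

/-- `L²`-norm form: `√(∫ (∂^w φ_k)²) ≤ √D_m` for `1 ≤ |w| ≤ m`. [folklore] -/
theorem sqrt_integral_sq_primFields_le {w : List (Fin 3)} {m : ℕ} (hw1 : 1 ≤ w.length)
    (hw : w.length ≤ m) (t : ℝ) (k : PIdx) :
    Real.sqrt (∫ y, iterPartialDeriv w (primFields ρ u ϑ t k) y ^ 2) ≤
      Real.sqrt (derivLevelEnergy ρ u ϑ m t) :=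
  Real.sqrt_le_sqrt (integral_sq_primFields_le_derivLevelEnergy hw1 hw t k)

/-- The number of nonempty words of length `≤ 3` over three letters is `3 + 9 + 27 = 39`.
[folklore] -/
theorem sum_card_words_Icc_one_three :
    ∑ n ∈ Finset.Icc 1 3, ((Finset.univ : Finset (Fin n → Fin 3)).card : ℝ) = 39 := by
  have h : Finset.Icc 1 3 = {1, 2, 3} := by decide
  rw [h]
  simp [Finset.card_univ, Fintype.card_fin]
  norm_num

end CompressibleEuler

end Literature.Analysis.FluidPDE

end
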